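import Literature.MathematicalPhysics.QuantumManyBody.BoseGasWallCutoff
import HarnessLib

/-!
# Smooth two-piece localisation of a many-body wave function across a coordinate slab (IMS)

Topic `Literature/MathematicalPhysics/QuantumManyBody`, namespace `…BoseGas`, over the carriers of
`BoseEinsteinCondensation.lean` (`Config N = (ℝ³)^N`, `kineticDensity`, `interaction`).  The
IMS localisation formula `∑_σ |∇(χ_σ Φ)|² = |∇Φ|² + |Φ|² ∑_σ |∇χ_σ|²` for a quadratic partition of
unity `∑_σ χ_σ² = 1`, in the product form needed to split the particles of an `N`-body wave
function into those below and those above a height `h₀` in one coordinate direction `a`: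

* `exists_splitProfile` — a `C¹` pair `c₀ = cos g`, `c₁ = sin g` on `ℝ` with `c₀² + c₁² = 1`,
  `c₀ c₀' + c₁ c₁' = 0`, `c₀'² + c₁'² ≤ (π²/(4δ))²`, `c₁ = 0` on `(-∞, h₀]`, `c₀ = 0` on `[h₀ + δ, ∞)`
  (from the explicit wall profile of `BoseGasWallCutoff.lean`);
* for a split `σ : Fin N → Fin 2` the localised function `X ↦ Φ(X) ∏ⱼ c_{σ j}(x_{j,a})`:
  it is `C¹` (`contDiff_loc`), symmetric under the permutations preserving `σ` if `Φ` is symmetric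
  (`loc_comp_perm`), vanishes where a particle sits on the wrong side
  (`loc_eq_zero_*`), the masses add up (`sum_ennnormSq_loc`: `∑_σ |χ_σΦ|² = |Φ|²`), and the
  **IMS bound** `sum_kineticDensity_loc_le`: `∑_σ |∇(χ_σΦ)|² ≤ |∇Φ|² + N D² |Φ|²` pointwise, where
  `D²` bounds `c₀'² + c₁'²` (the cross terms cancel because `∑_b c_b c_b' = 0`);

Standard (Ismagilov–Morgan–Simon / Sigal localisation); tagged folklore.  No definitions: the
localised function is written out.

## References

* [CFKS1987] H. L. Cycon, R. G. Froese, W. Kirsch, B. Simon, *Schrödinger Operators*, Springer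
  1987, Thm. 3.2 (IMS localization formula).
* [LSSY2005] E. H. Lieb, R. Seiringer, J. P. Solovej, J. Yngvason, *The Mathematics of the Bose
  Gas and its Condensation* (2005), Ch. 2 (the variational set-up).
-/

noncomputable section

namespace Literature.MathematicalPhysics.QuantumManyBody.BoseGas

open _root_.MeasureTheory _root_.Filter _root_.Set
open scoped ENNReal NNReal Topology BigOperators

/-! ### The profile pair -/

section Profile

open Real

/-- **A `C¹` quadratic partition of unity across a ramp.**  For `δ > 0` and a height `h₀` there
are `C¹` functions `c₀, c₁ : ℝ → [0,1]` (indexed by `Fin 2`) with `c₀² + c₁² = 1`,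
`c₀c₀' + c₁c₁' = 0`, `c₀'² + c₁'² ≤ (π²/(4δ))²`, `c₁ = 0` on `(-∞, h₀]` and `c₀ = 0` on
`[h₀ + δ, ∞)`: `c₀ = cos g`, `c₁ = sin g` with `g = (π/2)(1 - θ)` for the wall profile `θ` of
`WallCutoff.exists_wallProfile` (`θ = 1` left of `h₀`, `0` right of `h₀ + δ`, `|θ'| ≤ π/(2δ)`).
[folklore] -/
theorem exists_splitProfile (h₀ : ℝ) {δ : ℝ} (hδ : 0 < δ) :
    ∃ c : Fin 2 → ℝ → ℝ, (∀ b, ContDiff ℝ 1 (c b)) ∧ (∀ b t, 0 ≤ c b t ∧ c b t ≤ 1) ∧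
      (∀ t, ∑ b, c b t ^ 2 = 1) ∧ (∀ t, ∑ b, c b t * deriv (c b) t = 0) ∧
      (∀ t, ∑ b, deriv (c b) t ^ 2 ≤ (π ^ 2 / (4 * δ)) ^ 2) ∧
      (∀ t, t ≤ h₀ → c 1 t = 0) ∧ (∀ t, h₀ + δ ≤ t → c 0 t = 0) := by
  obtain ⟨θ, hθ, h01, hder, -, hone, hzero⟩ :=
    WallCutoff.exists_wallProfile (L := h₀ + 2 * δ) (w := δ) hδ
  rw [show h₀ + 2 * δ - 2 * δ = h₀ by ring] at hone
  rw [show h₀ + 2 * δ - δ = h₀ + δ by ring] at hzero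
  set g : ℝ → ℝ := fun t => π / 2 * (1 - θ t) with hg
  have hθd : ∀ t, HasDerivAt θ (deriv θ t) t := fun t =>
    ((hθ.differentiable one_ne_zero) t).hasDerivAt
  have hgd : ∀ t, HasDerivAt g (-(π / 2) * deriv θ t) t := by
    intro t
    have h := ((hθd t).const_sub 1).const_mul (π / 2)
    exact h.congr_deriv (by ring)
  have hg_cont : ContDiff ℝ 1 g := contDiff_const.mul (contDiff_const.sub hθ)
  have hg_mem : ∀ t, 0 ≤ g t ∧ g t ≤ π / 2 := by
    intro t
    obtain ⟨h0, h1⟩ := h01 t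
    exact ⟨by simp only [hg]; nlinarith [Real.pi_pos], by simp only [hg]; nlinarith [Real.pi_pos]⟩
  have hdc : ∀ t, deriv (fun t => Real.cos (g t)) t = -Real.sin (g t) * (-(π / 2) * deriv θ t) :=
    fun t => ((Real.hasDerivAt_cos (g t)).comp t (hgd t)).deriv
  have hds : ∀ t, deriv (fun t => Real.sin (g t)) t = Real.cos (g t) * (-(π / 2) * deriv θ t) :=
    fun t => ((Real.hasDerivAt_sin (g t)).comp t (hgd t)).deriv
  refine ⟨fun b => if b = 0 then fun t => Real.cos (g t) else fun t => Real.sin (g t),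
    ?_, ?_, ?_, ?_, ?_, ?_, ?_⟩
  · intro b
    by_cases hb : b = 0
    · simp only [hb, if_true]; exact Real.contDiff_cos.comp hg_cont
    · simp only [hb, if_false]; exact Real.contDiff_sin.comp hg_cont
  · intro b t
    obtain ⟨hg0, hg1⟩ := hg_mem t
    have hgπ : g t ≤ π := by linarith [Real.pi_pos]
    by_cases hb : b = 0
    · simp only [hb, if_true]
      exact ⟨Real.cos_nonneg_of_mem_Icc ⟨by linarith, hg1⟩, Real.cos_le_one _⟩
    · simp only [hb, if_false]
      exact ⟨Real.sin_nonneg_of_nonneg_of_le_pi hg0 hgπ, Real.sin_le_one _⟩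
  · intro t
    simp only [Fin.sum_univ_two, Fin.isValue, if_true, one_ne_zero, if_false]
    exact Real.cos_sq_add_sin_sq (g t)
  · intro t
    simp only [Fin.sum_univ_two, Fin.isValue, if_true, one_ne_zero, if_false, hdc, hds]
    ring
  · intro t
    simp only [Fin.sum_univ_two, Fin.isValue, if_true, one_ne_zero, if_false, hdc, hds]
    have h1 : (-Real.sin (g t) * (-(π / 2) * deriv θ t)) ^ 2 +
        (Real.cos (g t) * (-(π / 2) * deriv θ t)) ^ 2 = (π / 2) ^ 2 * deriv θ t ^ 2 := by
      nlinarith [Real.sin_sq_add_cos_sq (g t)]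
    rw [h1]
    have h2 : deriv θ t ^ 2 ≤ (π / (2 * δ)) ^ 2 := by
      have := hder t
      rw [← sq_abs]
      exact pow_le_pow_left₀ (abs_nonneg _) this 2
    calc (π / 2) ^ 2 * deriv θ t ^ 2 ≤ (π / 2) ^ 2 * (π / (2 * δ)) ^ 2 :=
          mul_le_mul_of_nonneg_left h2 (sq_nonneg _)
      _ = (π ^ 2 / (4 * δ)) ^ 2 := by field_simp; ring
  · intro t ht
    simp only [Fin.isValue, one_ne_zero, if_false, hg, hone t ht]
    simp
  · intro t ht
    simp only [Fin.isValue, if_true, hg, hzero t ht]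
    norm_num [Real.cos_pi_div_two]

end Profile

/-! ### The localised function: regularity, symmetry, support, mass -/

section Loc

variable {N : ℕ}

/-- The coordinate `X ↦ x_{j,a}` is a continuous linear functional on `(ℝ³)^N`. [folklore] -/
theorem contDiff_coord (j : Fin N) (a : Fin 3) : ContDiff ℝ 1 fun X : Config N => X j a :=
  ((EuclideanSpace.proj a).comp (ContinuousLinearMap.proj (R := ℝ) j) : Config N →L[ℝ] ℝ).contDiff

/-- The product weight `∏ⱼ c_{σ j}(x_{j,a})` is `C¹`. [folklore] -/
theorem contDiff_prodWeight {c : Fin 2 → ℝ → ℝ} (hc : ∀ b, ContDiff ℝ 1 (c b)) (a : Fin 3)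
    (σ : Fin N → Fin 2) : ContDiff ℝ 1 fun X : Config N => ∏ j, c (σ j) (X j a) :=
  contDiff_prod (t := Finset.univ) (f := fun j (X : Config N) => c (σ j) (X j a))
    fun j _ => (hc (σ j)).comp (contDiff_coord j a)

/-- The localised function `Φ · ∏ⱼ c_{σ j}(x_{j,a})` is `C¹`. [folklore] -/
theorem contDiff_loc {c : Fin 2 → ℝ → ℝ} (hc : ∀ b, ContDiff ℝ 1 (c b)) (a : Fin 3)
    (σ : Fin N → Fin 2) {Φ : Config N → ℂ} (hΦ : ContDiff ℝ 1 Φ) :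
    ContDiff ℝ 1 fun X : Config N => Φ X * ((∏ j, c (σ j) (X j a) : ℝ) : ℂ) :=
  hΦ.mul (Complex.ofRealCLM.contDiff.comp (contDiff_prodWeight hc a σ))

/-- The localised function inherits the symmetry of `Φ` under the permutations preserving the
split. [folklore] -/
theorem loc_comp_perm (c : Fin 2 → ℝ → ℝ) (a : Fin 3) (σ : Fin N → Fin 2) {Φ : Config N → ℂ}
    (hΦ : ∀ (π : Equiv.Perm (Fin N)) (X : Config N), Φ (X ∘ π) = Φ X)
    (π : Equiv.Perm (Fin N)) (hπ : ∀ j, σ (π j) = σ j) (X : Config N) :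
    Φ (X ∘ π) * ((∏ j, c (σ j) ((X ∘ π) j a) : ℝ) : ℂ) = Φ X * ((∏ j, c (σ j) (X j a) : ℝ) : ℂ) := by
  rw [hΦ π X]
  congr 2
  calc ∏ j, c (σ j) ((X ∘ π) j a) = ∏ j, c (σ (π j)) (X (π j) a) := by
        simp only [Function.comp_apply, hπ]
    _ = ∏ i, c (σ i) (X i a) := Equiv.prod_comp π (fun i => c (σ i) (X i a))

/-- The localised function vanishes as soon as a particle of the upper piece (`σ j = 1`) lies
below the ramp. [folklore] -/
theorem loc_eq_zero_of_upper_le {c : Fin 2 → ℝ → ℝ} {h₀ : ℝ} (hc1 : ∀ t, t ≤ h₀ → c 1 t = 0)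
    (a : Fin 3) (σ : Fin N → Fin 2) (Φ : Config N → ℂ) {X : Config N} {j : Fin N}
    (hj : σ j = 1) (hX : X j a ≤ h₀) :
    Φ X * ((∏ j, c (σ j) (X j a) : ℝ) : ℂ) = 0 := by
  rw [Finset.prod_eq_zero (Finset.mem_univ j) (by rw [hj]; exact hc1 _ hX)]
  simp

/-- The localised function vanishes as soon as a particle of the lower piece (`σ j = 0`) lies
above the ramp. [folklore] -/
theorem loc_eq_zero_of_lower_ge {c : Fin 2 → ℝ → ℝ} {h₀ δ : ℝ}
    (hc0 : ∀ t, h₀ + δ ≤ t → c 0 t = 0) (a : Fin 3) (σ : Fin N → Fin 2) (Φ : Config N → ℂ)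
    {X : Config N} {j : Fin N} (hj : σ j = 0) (hX : h₀ + δ ≤ X j a) :
    Φ X * ((∏ j, c (σ j) (X j a) : ℝ) : ℂ) = 0 := by
  rw [Finset.prod_eq_zero (Finset.mem_univ j) (by rw [hj]; exact hc0 _ hX)]
  simp

/-- `∑_σ ∏ⱼ f_j(σ j) = ∏ⱼ ∑_b f_j(b)` over the splits `σ : Fin N → Fin 2`. [folklore] -/
theorem sum_prod_split (f : Fin N → Fin 2 → ℝ) :
    ∑ σ : Fin N → Fin 2, ∏ j, f j (σ j) = ∏ j, ∑ b, f j b :=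
  (Fintype.prod_sum f).symm

/-- The squared weights of the splits add up to one: `∑_σ (∏ⱼ c_{σ j}(t_j))² = 1`. [folklore] -/
theorem sum_prod_sq_eq_one {c : Fin 2 → ℝ → ℝ} (hsq : ∀ t, ∑ b, c b t ^ 2 = 1)
    (t : Fin N → ℝ) : ∑ σ : Fin N → Fin 2, (∏ j, c (σ j) (t j)) ^ 2 = 1 := by
  calc ∑ σ : Fin N → Fin 2, (∏ j, c (σ j) (t j)) ^ 2
      = ∑ σ : Fin N → Fin 2, ∏ j, c (σ j) (t j) ^ 2 := by
        simp_rw [Finset.prod_pow]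
    _ = ∏ j : Fin N, ∑ b, c b (t j) ^ 2 := sum_prod_split fun j b => c b (t j) ^ 2
    _ = 1 := by simp [hsq]

/-- **The masses of the pieces add up**: `∑_σ |Φ ∏ⱼ c_{σ j}(x_{j,a})|² = |Φ|²` pointwise.
[folklore] -/
theorem sum_ennnormSq_loc {c : Fin 2 → ℝ → ℝ} (hsq : ∀ t, ∑ b, c b t ^ 2 = 1) (a : Fin 3)
    (Φ : Config N → ℂ) (X : Config N) :
    ∑ σ : Fin N → Fin 2, ((‖Φ X * ((∏ j, c (σ j) (X j a) : ℝ) : ℂ)‖₊ : ℝ≥0∞)) ^ 2 =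
      ((‖Φ X‖₊ : ℝ≥0∞)) ^ 2 := by
  have h : ∀ σ : Fin N → Fin 2, ((‖Φ X * ((∏ j, c (σ j) (X j a) : ℝ) : ℂ)‖₊ : ℝ≥0∞)) ^ 2 =
      ENNReal.ofReal (‖Φ X‖ ^ 2 * (∏ j, c (σ j) (X j a)) ^ 2) := by
    intro σ
    rw [ennnorm_sq_eq_ofReal, norm_mul, Complex.norm_real, Real.norm_eq_abs, mul_pow, sq_abs]
  simp_rw [h]
  rw [← ENNReal.ofReal_sum_of_nonneg fun σ _ => by positivity, ← Finset.mul_sum,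
    sum_prod_sq_eq_one hsq, mul_one, ennnorm_sq_eq_ofReal]

/-! ### The IMS bound -/

/-- The coordinate functional on the coordinate directions. [folklore] -/
theorem coordFun_single (j i : Fin N) (a k : Fin 3) :
    ((EuclideanSpace.proj a).comp (ContinuousLinearMap.proj (R := ℝ) j) : Config N →L[ℝ] ℝ)
      (Pi.single i (EuclideanSpace.single k (1 : ℝ))) = if j = i ∧ a = k then 1 else 0 := by
  change (Pi.single i (EuclideanSpace.single k (1 : ℝ)) : Config N) j a = _
  by_cases hj : j = i
  · subst hj
    by_cases ha : a = k
    · subst ha; simp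
    · simp [ha]
  · simp [hj]

/-- **Partial derivatives of the product weight**: `∂_{i,k} ∏ⱼ c_{σ j}(x_{j,a}) =
[k = a] c'_{σ i}(x_{i,a}) ∏_{j ≠ i} c_{σ j}(x_{j,a})`. [folklore] -/
theorem fderiv_prodWeight_single {c : Fin 2 → ℝ → ℝ} (hc : ∀ b, ContDiff ℝ 1 (c b)) (a : Fin 3)
    (σ : Fin N → Fin 2) (X : Config N) (i : Fin N) (k : Fin 3) :
    fderiv ℝ (fun X : Config N => ∏ j, c (σ j) (X j a)) X
        (Pi.single i (EuclideanSpace.single k (1 : ℝ))) =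
      if a = k then deriv (c (σ i)) (X i a) * ∏ j ∈ Finset.univ.erase i, c (σ j) (X j a) else 0 := by
  classical
  set e : Fin N → (Config N →L[ℝ] ℝ) := fun j =>
    ((EuclideanSpace.proj a).comp (ContinuousLinearMap.proj (R := ℝ) j) : Config N →L[ℝ] ℝ)
    with he
  have hfac : ∀ j : Fin N, HasFDerivAt (fun X : Config N => c (σ j) (X j a))
      (deriv (c (σ j)) (X j a) • e j) X := fun j =>
    (((hc (σ j)).differentiable one_ne_zero) (X j a)).hasDerivAt.comp_hasFDerivAt X (e j).hasFDerivAt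
  have hprod := HasFDerivAt.finsetProd (u := Finset.univ) fun j _ => hfac j
  rw [hprod.fderiv]
  have hej : ∀ j : Fin N, e j (Pi.single i (EuclideanSpace.single k (1 : ℝ))) =
      if j = i ∧ a = k then 1 else 0 := fun j => coordFun_single j i a k
  simp only [FunLike.coe_sum, Finset.sum_apply, FunLike.coe_smul,
    Pi.smul_apply, hej, smul_eq_mul, mul_ite, mul_one, mul_zero]
  by_cases hak : a = k
  · simp only [hak, and_true, Finset.sum_ite_eq', Finset.mem_univ, if_true]
    ring
  · simp [hak]

/-- **Derivative of the localised function** along `δ_{i,k}`: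
`∂_{i,k}(Φ W_σ) = W_σ ∂_{i,k}Φ + Φ ∂_{i,k}W_σ`, `W_σ = ∏ⱼ c_{σ j}(x_{j,a})`. [folklore] -/
theorem fderiv_loc_single {c : Fin 2 → ℝ → ℝ} (hc : ∀ b, ContDiff ℝ 1 (c b)) (a : Fin 3)
    (σ : Fin N → Fin 2) {Φ : Config N → ℂ} (hΦ : ContDiff ℝ 1 Φ) (X : Config N) (i : Fin N)
    (k : Fin 3) :
    fderiv ℝ (fun X : Config N => Φ X * ((∏ j, c (σ j) (X j a) : ℝ) : ℂ)) X
        (Pi.single i (EuclideanSpace.single k (1 : ℝ))) =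
      ((∏ j, c (σ j) (X j a) : ℝ) : ℂ) * fderiv ℝ Φ X (Pi.single i (EuclideanSpace.single k (1 : ℝ))) +
        Φ X * ((if a = k then deriv (c (σ i)) (X i a) * ∏ j ∈ Finset.univ.erase i, c (σ j) (X j a)
          else 0 : ℝ) : ℂ) := by
  classical
  have hW : HasFDerivAt (fun X : Config N => ∏ j, c (σ j) (X j a))
      (fderiv ℝ (fun X : Config N => ∏ j, c (σ j) (X j a)) X) X :=
    ((contDiff_prodWeight hc a σ).differentiable one_ne_zero X).hasFDerivAt
  have hWc : HasFDerivAt (fun X : Config N => ((∏ j, c (σ j) (X j a) : ℝ) : ℂ))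
      (Complex.ofRealCLM.comp (fderiv ℝ (fun X : Config N => ∏ j, c (σ j) (X j a)) X)) X :=
    Complex.ofRealCLM.hasFDerivAt.comp X hW
  have hΦ' : HasFDerivAt Φ (fderiv ℝ Φ X) X := (hΦ.differentiable one_ne_zero X).hasFDerivAt
  have hprod : HasFDerivAt (fun X : Config N => Φ X * ((∏ j, c (σ j) (X j a) : ℝ) : ℂ))
      (Φ X • Complex.ofRealCLM.comp (fderiv ℝ (fun X : Config N => ∏ j, c (σ j) (X j a)) X) +
        ((∏ j, c (σ j) (X j a) : ℝ) : ℂ) • fderiv ℝ Φ X) X := hΦ'.mul hWc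
  rw [hprod.fderiv]
  simp only [_root_.add_apply, _root_.smul_apply,
    ContinuousLinearMap.coe_comp, Function.comp_apply, Complex.ofRealCLM_apply, smul_eq_mul,
    fderiv_prodWeight_single hc a σ X i k]
  ring

/-- The algebra of the cross terms: `∑_σ ‖P_σ z + Q_σ w‖² = ‖z‖² ∑_σ P_σ² + ‖w‖² ∑_σ Q_σ²` when
`∑_σ P_σ Q_σ = 0` (real `P_σ, Q_σ`, complex `z, w`). [folklore] -/
theorem sum_norm_sq_real_combination {ι : Type*} (s : Finset ι) (P Q : ι → ℝ) (z w : ℂ)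
    (hPQ : ∑ σ ∈ s, P σ * Q σ = 0) :
    ∑ σ ∈ s, ‖(P σ : ℂ) * z + w * (Q σ : ℂ)‖ ^ 2 =
      ‖z‖ ^ 2 * ∑ σ ∈ s, P σ ^ 2 + ‖w‖ ^ 2 * ∑ σ ∈ s, Q σ ^ 2 := by
  have hterm : ∀ σ, ‖(P σ : ℂ) * z + w * (Q σ : ℂ)‖ ^ 2 =
      P σ ^ 2 * ‖z‖ ^ 2 + Q σ ^ 2 * ‖w‖ ^ 2 +
        2 * (P σ * Q σ) * (z.re * w.re + z.im * w.im) := by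
    intro σ
    rw [Complex.sq_norm, Complex.sq_norm, Complex.sq_norm, Complex.normSq_apply,
      Complex.normSq_apply, Complex.normSq_apply]
    simp only [Complex.add_re, Complex.add_im, Complex.mul_re, Complex.mul_im,
      Complex.ofReal_re, Complex.ofReal_im]
    ring
  simp_rw [hterm]
  rw [Finset.sum_add_distrib, Finset.sum_add_distrib, ← Finset.sum_mul, ← Finset.sum_mul,
    ← Finset.sum_mul, ← Finset.mul_sum, hPQ]
  ring

/-- **The IMS bound, one coordinate direction.**  With `∑_b c_b² = 1`, `∑_b c_b c_b' = 0` and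
`∑_b c_b'² ≤ D²`: `∑_σ |∂_{i,k}(Φ W_σ)|² ≤ |∂_{i,k}Φ|² + [k = a] D² |Φ|²` pointwise. [folklore] -/
theorem sum_ennnormSq_fderiv_loc_le {c : Fin 2 → ℝ → ℝ} (hc : ∀ b, ContDiff ℝ 1 (c b))
    (hsq : ∀ t, ∑ b, c b t ^ 2 = 1) (horth : ∀ t, ∑ b, c b t * deriv (c b) t = 0) {D : ℝ}
    (hD : ∀ t, ∑ b, deriv (c b) t ^ 2 ≤ D ^ 2) (a : Fin 3) {Φ : Config N → ℂ}
    (hΦ : ContDiff ℝ 1 Φ) (X : Config N) (i : Fin N) (k : Fin 3) :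
    ∑ σ : Fin N → Fin 2, ((‖fderiv ℝ (fun X : Config N => Φ X * ((∏ j, c (σ j) (X j a) : ℝ) : ℂ)) X
        (Pi.single i (EuclideanSpace.single k (1 : ℝ)))‖₊ : ℝ≥0∞)) ^ 2 ≤
      ((‖fderiv ℝ Φ X (Pi.single i (EuclideanSpace.single k (1 : ℝ)))‖₊ : ℝ≥0∞)) ^ 2 +
        (if a = k then ENNReal.ofReal (D ^ 2) else 0) * ((‖Φ X‖₊ : ℝ≥0∞)) ^ 2 := by
  classical
  set z : ℂ := fderiv ℝ Φ X (Pi.single i (EuclideanSpace.single k (1 : ℝ))) with hz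
  set w : ℂ := Φ X with hw
  set P : (Fin N → Fin 2) → ℝ := fun σ => ∏ j, c (σ j) (X j a) with hP
  set Q : (Fin N → Fin 2) → ℝ := fun σ =>
    if a = k then deriv (c (σ i)) (X i a) * ∏ j ∈ Finset.univ.erase i, c (σ j) (X j a) else 0 with hQ
  have hderiv : ∀ σ : Fin N → Fin 2,
      fderiv ℝ (fun X : Config N => Φ X * ((∏ j, c (σ j) (X j a) : ℝ) : ℂ)) X
        (Pi.single i (EuclideanSpace.single k (1 : ℝ))) = (P σ : ℂ) * z + w * (Q σ : ℂ) := by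
    intro σ
    rw [fderiv_loc_single hc a σ hΦ X i k]
  -- `Q` as a product with the factor `i` replaced
  have hQprod : ∀ σ : Fin N → Fin 2, a = k →
      Q σ = ∏ j, (if j = i then deriv (c (σ j)) (X j a) else c (σ j) (X j a)) := by
    intro σ hak
    simp only [hQ, hak, if_true]
    rw [← Finset.mul_prod_erase Finset.univ _ (Finset.mem_univ i)]
    simp only [if_true]
    congr 1
    exact Finset.prod_congr rfl fun j hj => by rw [if_neg (Finset.ne_of_mem_erase hj)]
  -- the three sums over the splits
  have hPP : ∑ σ : Fin N → Fin 2, P σ ^ 2 = 1 := sum_prod_sq_eq_one hsq fun j => X j a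
  have hPQ : ∑ σ : Fin N → Fin 2, P σ * Q σ = 0 := by
    by_cases hak : a = k
    · have h1 : ∀ σ : Fin N → Fin 2, P σ * Q σ =
          ∏ j, c (σ j) (X j a) * (if j = i then deriv (c (σ j)) (X j a) else c (σ j) (X j a)) := by
        intro σ; rw [hQprod σ hak, hP, ← Finset.prod_mul_distrib]
      simp_rw [h1]
      rw [sum_prod_split fun j b => c b (X j a) * (if j = i then deriv (c b) (X j a) else c b (X j a))]
      exact Finset.prod_eq_zero (Finset.mem_univ i) (by simp only [if_true]; exact horth _)
    · simp [hQ, hak]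
  have hQQ : ∑ σ : Fin N → Fin 2, Q σ ^ 2 ≤ if a = k then D ^ 2 else 0 := by
    by_cases hak : a = k
    · have h1 : ∀ σ : Fin N → Fin 2, Q σ ^ 2 =
          ∏ j, (if j = i then deriv (c (σ j)) (X j a) else c (σ j) (X j a)) ^ 2 := by
        intro σ; rw [hQprod σ hak, ← Finset.prod_pow]
      simp_rw [h1]
      rw [sum_prod_split fun j b => (if j = i then deriv (c b) (X j a) else c b (X j a)) ^ 2,
        if_pos hak, ← Finset.mul_prod_erase Finset.univ _ (Finset.mem_univ i)]
      simp only [if_true]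
      have hrest : ∏ j ∈ Finset.univ.erase i,
          ∑ b, (if j = i then deriv (c b) (X j a) else c b (X j a)) ^ 2 = 1 :=
        Finset.prod_eq_one fun j hj => by
          simp only [Finset.ne_of_mem_erase hj, if_false]; exact hsq _
      rw [hrest, mul_one]
      exact hD _
    · simp [hQ, hak]
  -- assemble in `ℝ`, then pass to `ℝ≥0∞`
  have hreal : ∑ σ : Fin N → Fin 2, ‖(P σ : ℂ) * z + w * (Q σ : ℂ)‖ ^ 2 ≤
      ‖z‖ ^ 2 + (if a = k then D ^ 2 else 0) * ‖w‖ ^ 2 := by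
    rw [sum_norm_sq_real_combination Finset.univ P Q z w hPQ, hPP, mul_one, mul_comm (‖w‖ ^ 2)]
    gcongr
  have hnn : 0 ≤ (if a = k then D ^ 2 else 0 : ℝ) := by split_ifs <;> positivity
  simp_rw [hderiv, ennnorm_sq_eq_ofReal]
  rw [← ENNReal.ofReal_sum_of_nonneg fun σ _ => by positivity]
  refine (ENNReal.ofReal_le_ofReal hreal).trans (le_of_eq ?_)
  rw [ENNReal.ofReal_add (by positivity) (by positivity), ENNReal.ofReal_mul hnn]
  congr 1
  split_ifs <;> simp

/-- **The IMS bound**: `∑_σ |∇(Φ W_σ)|² ≤ |∇Φ|² + N D² |Φ|²` pointwise. [folklore] -/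
theorem sum_kineticDensity_loc_le {c : Fin 2 → ℝ → ℝ} (hc : ∀ b, ContDiff ℝ 1 (c b))
    (hsq : ∀ t, ∑ b, c b t ^ 2 = 1) (horth : ∀ t, ∑ b, c b t * deriv (c b) t = 0) {D : ℝ}
    (hD : ∀ t, ∑ b, deriv (c b) t ^ 2 ≤ D ^ 2) (a : Fin 3) {Φ : Config N → ℂ}
    (hΦ : ContDiff ℝ 1 Φ) (X : Config N) :
    ∑ σ : Fin N → Fin 2, kineticDensity (fun X : Config N => Φ X * ((∏ j, c (σ j) (X j a) : ℝ) : ℂ)) X ≤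
      kineticDensity Φ X + N * ENNReal.ofReal (D ^ 2) * ((‖Φ X‖₊ : ℝ≥0∞)) ^ 2 := by
  unfold kineticDensity
  rw [Finset.sum_comm]
  have hi : ∀ i : Fin N, ∑ σ : Fin N → Fin 2, ∑ k : Fin 3,
      ((‖fderiv ℝ (fun X : Config N => Φ X * ((∏ j, c (σ j) (X j a) : ℝ) : ℂ)) X
        (Pi.single i (EuclideanSpace.single k (1 : ℝ)))‖₊ : ℝ≥0∞)) ^ 2 ≤
      (∑ k : Fin 3, ((‖fderiv ℝ Φ X (Pi.single i (EuclideanSpace.single k (1 : ℝ)))‖₊ : ℝ≥0∞)) ^ 2) +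
        ENNReal.ofReal (D ^ 2) * ((‖Φ X‖₊ : ℝ≥0∞)) ^ 2 := by
    intro i
    rw [Finset.sum_comm]
    calc ∑ k : Fin 3, ∑ σ : Fin N → Fin 2,
          ((‖fderiv ℝ (fun X : Config N => Φ X * ((∏ j, c (σ j) (X j a) : ℝ) : ℂ)) X
            (Pi.single i (EuclideanSpace.single k (1 : ℝ)))‖₊ : ℝ≥0∞)) ^ 2
        ≤ ∑ k : Fin 3, (((‖fderiv ℝ Φ X (Pi.single i (EuclideanSpace.single k (1 : ℝ)))‖₊ : ℝ≥0∞)) ^ 2 +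
            (if a = k then ENNReal.ofReal (D ^ 2) else 0) * ((‖Φ X‖₊ : ℝ≥0∞)) ^ 2) :=
          Finset.sum_le_sum fun k _ => sum_ennnormSq_fderiv_loc_le hc hsq horth hD a hΦ X i k
      _ = _ := by
          rw [Finset.sum_add_distrib, ← Finset.sum_mul, Finset.sum_ite_eq Finset.univ a]
          simp
  calc ∑ i : Fin N, ∑ σ : Fin N → Fin 2, ∑ k : Fin 3,
        ((‖fderiv ℝ (fun X : Config N => Φ X * ((∏ j, c (σ j) (X j a) : ℝ) : ℂ)) X
          (Pi.single i (EuclideanSpace.single k (1 : ℝ)))‖₊ : ℝ≥0∞)) ^ 2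
      ≤ ∑ i : Fin N, ((∑ k : Fin 3, ((‖fderiv ℝ Φ X (Pi.single i (EuclideanSpace.single k (1 : ℝ)))‖₊ :
          ℝ≥0∞)) ^ 2) + ENNReal.ofReal (D ^ 2) * ((‖Φ X‖₊ : ℝ≥0∞)) ^ 2) :=
        Finset.sum_le_sum fun i _ => hi i
    _ = _ := by
        rw [Finset.sum_add_distrib, Finset.sum_const, Finset.card_univ, Fintype.card_fin,
          nsmul_eq_mul, mul_assoc]

end Loc

end Literature.MathematicalPhysics.QuantumManyBody.BoseGas

end
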